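import Summits.KontsevichZagierPeriods.KontsevichZagierPeriods.Theorems.LinRedNormalFormArrangementNormalFormStubRebaseSimplePosOneFibreCornerBands

/-!
# Stub `stub_rebaseSimplePosOneZero` (crux `ArrangementNormalForm`, line `janus-bands`) —
part `CornerLocal`: the two sector pieces of a normalised corner

Corner toolkit for the double-corner bands at `B = 1`, fifth file. A double-corner band in
NORMALISED position: base `(x, y)`, base pole `y = 0`, letter `0`, transverse bounds
`u < t < v` and `y`-free apex level `κ = k x` all through the origin, `u − κ = A (v − u)`,
`A > 0`, base cell in the open quadrant `{x > 0, y > 0}`, in one of the two residual regimes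
(`bif far then … else …`: `Hthick` `κ < 0 < u < v`, or `Hfar` `0 < κ`, `u < v`, `2κ ≤ v`).
The two sector pieces of its localisation to the box `(0, ε)²` are good:
* `RebasePos.good_flatPiece` — the flat piece `{0 < y < x < ε}`: after `RebasePos.cornerBlowUp`
  the apex level is the non-zero constant `k`, so the blown-up band has no corner
  (`good_thick_of_noCorner₂` / `good_far_of_noCorner₂`);
* `RebasePos.good_steepPiece` — the steep piece `{0 < x < y < ε}`: after
  `RebasePos.cornerBlowUpSteep` the bounds depend on `ξ = x/y` only (`RebasePos.good_xfree_band`).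
Also: the regime dictionary and the choice of the box (`RebasePos.exists_box_eps`: rows not
through the corner are inactive near it). Registered as `rebaseSimplePos_steepPiece`.

References: M. Kontsevich, D. Zagier, *Periods* (2001), §1.2, rules (1a), (2).
-/

noncomputable section

open Set MeasureTheory MvPolynomial
open Literature.NumberTheory.Transcendental Literature.ModelTheory.ExponentialFields

namespace Summit.KontsevichZagierPeriods.ArrangementNormalForm.JanusBands

namespace RebasePos

open SeparatePos

section Regime

/-!
The two residual regimes of a band above its apex level `κ` are written inline as
`bif far then (0 < κ ∧ u < v ∧ 2κ ≤ v) else (κ < 0 ∧ 0 < u ∧ u < v)`: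
`far = false` is `Hthick`, `far = true` is `Hfar`.
-/

/-- Both regimes are invariant under positive scaling. -/
theorem reg_mul (far : Bool) {r k a b : ℝ} (hr : 0 < r) :
    (bif far then (0 < r * k ∧ r * a < r * b ∧ 2 * (r * k) ≤ r * b)
      else (r * k < 0 ∧ 0 < r * a ∧ r * a < r * b)) ↔
    (bif far then (0 < k ∧ a < b ∧ 2 * k ≤ b) else (k < 0 ∧ 0 < a ∧ a < b)) := by
  cases far
  · simp only [cond_false]
    constructor
    · rintro ⟨h1, h2, h3⟩
      exact ⟨by nlinarith, pos_of_mul_pos_right h2 hr.le, lt_of_mul_lt_mul_left h3 hr.le⟩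
    · rintro ⟨h1, h2, h3⟩
      exact ⟨by nlinarith, mul_pos hr h2, mul_lt_mul_of_pos_left h3 hr⟩
  · simp only [cond_true]
    constructor
    · rintro ⟨h1, h2, h3⟩
      exact ⟨pos_of_mul_pos_right h1 hr.le, lt_of_mul_lt_mul_left h2 hr.le, by nlinarith⟩
    · rintro ⟨h1, h2, h3⟩
      exact ⟨mul_pos hr h1, mul_lt_mul_of_pos_left h2 hr, by nlinarith⟩

/-- In both regimes the band lies above the letter: `0 < u < v`. -/
theorem reg_pos (far : Bool) {k a b A : ℝ}
    (h : bif far then (0 < k ∧ a < b ∧ 2 * k ≤ b) else (k < 0 ∧ 0 < a ∧ a < b))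
    (hA : a - k = A * (b - a)) (hA0 : 0 < A) : 0 < a ∧ a < b := by
  cases far
  · simp only [cond_false] at h
    exact ⟨h.2.1, h.2.2⟩
  · simp only [cond_true] at h
    obtain ⟨h1, h2, -⟩ := h
    exact ⟨by nlinarith, h2⟩

/-- In both regimes the apex level does not vanish. -/
theorem reg_ne (far : Bool) {k a b : ℝ}
    (h : bif far then (0 < k ∧ a < b ∧ 2 * k ≤ b) else (k < 0 ∧ 0 < a ∧ a < b)) : k ≠ 0 := by
  cases far
  · simp only [cond_false] at h
    exact h.1.ne
  · simp only [cond_true] at h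
    exact h.1.ne'

variable {B m m' : ℕ} (L : Fin m → (Fin B → ℚ) × ℚ) (e : Fin m → ℕ) (ℓ₁ ℓ₂ : (Fin B → ℚ) × ℚ) (n₁ n₂ : ℕ)

/-- **Both regimes without corner on the closed cell** (`good_thick_of_noCorner₂`,
`good_far_of_noCorner₂`). -/
theorem good_noCorner_reg (far : Bool) (s : KZ.IntegralRep (B + 1 + 1)) (M : Fin m' → (Fin (B + 1) → ℚ) × ℚ)
    (p : MvPolynomial (Fin B) ℚ) (u v κ : (Fin (B + 1) → ℚ) × ℚ) (A : ℚ)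
    (h12 : n₁ = 0 ∨ n₂ = 0) (hbd : Bornology.IsBounded s.domain)
    (hdom : s.domain = gDom B 1 m' M (fun _ => Sum.inr u) (fun _ => Sum.inr v))
    (hint : EqOn s.integrand (glit B 1 p L e ℓ₁ ℓ₂ n₁ n₂ (fun _ => some 0)) s.domain)
    (hA : u - κ = A • (v - u)) (hA0 : 0 < A)
    (hcell : ∀ z : Fin (B + 1 + 1) → ℝ, (∀ j, 0 < affF B 1 (M j) z) →
      bif far then (0 < affF B 1 κ z ∧ affF B 1 u z < affF B 1 v z ∧ 2 * affF B 1 κ z ≤ affF B 1 v z)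
      else (affF B 1 κ z < 0 ∧ 0 < affF B 1 u z ∧ affF B 1 u z < affF B 1 v z))
    (hnc : ∀ z ∈ closure {z : Fin (B + 1 + 1) → ℝ | ∀ j, 0 < affF B 1 (M j) z},
      affF B 1 κ z = 0 → affF B 1 u z = 0 → affF B 1 v z = 0 → False) :
    ∃ c ∈ AddSubgroup.closure (GGset B 2 1), KZ.of s - c ∈ KZ.relations := by
  cases far
  · exact good_thick_of_noCorner₂ L e ℓ₁ ℓ₂ n₁ n₂ s M p u v κ A h12 hbd hdom hint hA hA0
      (fun z hz => by simpa only [cond_false] using hcell z hz) hnc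
  · exact good_far_of_noCorner₂ L e ℓ₁ ℓ₂ n₁ n₂ s M p u v κ A h12 hbd hdom hint hA hA0
      (fun z hz => by simpa only [cond_true] using hcell z hz) hnc

end Regime

section Box

variable {m' : ℕ}

/-- **Choice of the box.** If every row is non-negative at the origin, there is a rational
`ε > 0` such that every row NOT through the origin is positive on the box `(0, ε)²`. -/
theorem exists_box_eps (M : Fin m' → (Fin (1 + 1) → ℚ) × ℚ) (hM0 : ∀ j, 0 ≤ (M j).2) :
    ∃ ε : ℚ, 0 < ε ∧ ∀ j, (M j).2 ≠ 0 → ∀ z : Fin (1 + 1 + 1) → ℝ,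
      0 < z 0 → z 0 < ε → 0 < z 1 → z 1 < ε → 0 < affF 1 1 (M j) z := by
  set δ : Fin m' → ℝ := fun j => if (M j).2 = 0 then 1 else
    ((M j).2 : ℝ) / (|((M j).1 0 : ℝ)| + |((M j).1 1 : ℝ)| + 1) with hδ
  have hδpos : ∀ j, (0 : ℝ) < δ j := fun j => by
    simp only [hδ]
    split_ifs with h
    · exact one_pos
    · have hc : (0 : ℝ) < (M j).2 := by exact_mod_cast lt_of_le_of_ne (hM0 j) (Ne.symm h)
      positivity
  obtain ⟨ε₀, hε₀, hlt⟩ := Pi.exists_forall_pos_add_lt (x := fun _ : Fin m' => (0 : ℝ)) (y := δ) hδpos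
  obtain ⟨ε, hε, hεε₀⟩ := exists_rat_btwn hε₀
  refine ⟨ε, by exact_mod_cast hε, fun j hj z hx hxε hy hyε => ?_⟩
  have hc : (0 : ℝ) < (M j).2 := by exact_mod_cast lt_of_le_of_ne (hM0 j) (Ne.symm hj)
  have hδj : δ j = ((M j).2 : ℝ) / (|((M j).1 0 : ℝ)| + |((M j).1 1 : ℝ)| + 1) := by
    simp only [hδ, if_neg hj]
  have hεδ : (ε : ℝ) < δ j := by have := hlt j; simp only [zero_add] at this; linarith
  rw [hδj, lt_div_iff₀ (by positivity)] at hεδ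
  rw [affF_two]
  have h1 : -(|((M j).1 0 : ℝ)| * ε) ≤ ((M j).1 0 : ℝ) * z 0 := by
    have : |((M j).1 0 : ℝ) * z 0| ≤ |((M j).1 0 : ℝ)| * ε := by
      rw [abs_mul, abs_of_pos hx]
      exact mul_le_mul_of_nonneg_left hxε.le (abs_nonneg _)
    linarith [neg_abs_le (((M j).1 0 : ℝ) * z 0)]
  have h2 : -(|((M j).1 1 : ℝ)| * ε) ≤ ((M j).1 1 : ℝ) * z 1 := by
    have : |((M j).1 1 : ℝ) * z 1| ≤ |((M j).1 1 : ℝ)| * ε := by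
      rw [abs_mul, abs_of_pos hy]
      exact mul_le_mul_of_nonneg_left hyε.le (abs_nonneg _)
    linarith [neg_abs_le (((M j).1 1 : ℝ) * z 1)]
  nlinarith

/-- The cleaned rows of the box piece: rows through the origin are kept, the others (inactive
on the box) are replaced by the trivial row `1 > 0`. -/
def boxM (M : Fin m' → (Fin (1 + 1) → ℚ) × ℚ) (j : Fin m') : (Fin (1 + 1) → ℚ) × ℚ :=
  if (M j).2 = 0 then M j else ((0 : Fin (1 + 1) → ℚ), 1)

/-- The cleaned rows pass through the origin unless they are `y`-free. -/
theorem boxM_origin (M : Fin m' → (Fin (1 + 1) → ℚ) × ℚ) (j : Fin m') :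
    (boxM M j).1 1 ≠ 0 → (boxM M j).2 = 0 := by
  unfold boxM
  split_ifs with h
  · exact fun _ => h
  · intro h'
    exact absurd rfl h'

/-- On the box, the cleaned rows are equivalent to the original rows. -/
theorem boxM_iff (M : Fin m' → (Fin (1 + 1) → ℚ) × ℚ) (ε : ℚ)
    (hε : ∀ j, (M j).2 ≠ 0 → ∀ z : Fin (1 + 1 + 1) → ℝ,
      0 < z 0 → z 0 < ε → 0 < z 1 → z 1 < ε → 0 < affF 1 1 (M j) z)
    (z : Fin (1 + 1 + 1) → ℝ) (hx : 0 < z 0) (hxε : z 0 < ε) (hy : 0 < z 1) (hyε : z 1 < ε) :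
    (∀ j, 0 < affF 1 1 (boxM M j) z) ↔ (∀ j, 0 < affF 1 1 (M j) z) := by
  refine forall_congr' fun j => ?_
  unfold boxM
  split_ifs with h
  · exact Iff.rfl
  · constructor
    · exact fun _ => hε j h z hx hxε hy hyε
    · intro _
      rw [affF_two]
      simp

end Box

section Pieces

variable {m m' : ℕ}

/-- `chartFL` is additive. -/
theorem chartFL_sub (c c' : (Fin (1 + 1) → ℚ) × ℚ) : chartFL (c - c') = chartFL c - chartFL c' := by
  refine Prod.ext (funext fun i => ?_) ?_
  · fin_cases i <;> simp [chartFL]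
  · simp [chartFL]

/-- `chartFL` is homogeneous. -/
theorem chartFL_smul (A : ℚ) (c : (Fin (1 + 1) → ℚ) × ℚ) : chartFL (A • c) = A • chartFL c := by
  refine Prod.ext (funext fun i => ?_) ?_
  · fin_cases i <;> simp [chartFL]
  · simp [chartFL]

/-- `chartFU` is additive. -/
theorem chartFU_sub (c c' : (Fin (1 + 1) → ℚ) × ℚ) : chartFU (c - c') = chartFU c - chartFU c' := by
  refine Prod.ext (funext fun i => ?_) ?_
  · fin_cases i <;> simp [chartFU]
  · simp [chartFU]

/-- `chartFU` is homogeneous. -/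
theorem chartFU_smul (A : ℚ) (c : (Fin (1 + 1) → ℚ) × ℚ) : chartFU (A • c) = A • chartFU c := by
  refine Prod.ext (funext fun i => ?_) ?_
  · fin_cases i <;> simp [chartFU]
  · simp [chartFU]

/-- The apex relation is transported by a linear map of forms. -/
theorem apex_map {F : ((Fin (1 + 1) → ℚ) × ℚ) → ((Fin (1 + 1) → ℚ) × ℚ)}
    (hsub : ∀ c c', F (c - c') = F c - F c') (hsmul : ∀ (A : ℚ) c, F (A • c) = A • F c)
    {u v κ : (Fin (1 + 1) → ℚ) × ℚ} {A : ℚ} (hA : u - κ = A • (v - u)) :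
    F u - F κ = A • (F v - F u) := by
  have h := congrArg F hA
  rwa [hsub, hsmul, hsub] at h

/-- The apex relation evaluated at a point. -/
theorem apex_eval {u v κ : (Fin (1 + 1) → ℚ) × ℚ} {A : ℚ} (hA : u - κ = A • (v - u))
    (z : Fin (1 + 1 + 1) → ℝ) : affF 1 1 u z - affF 1 1 κ z = (A : ℝ) * (affF 1 1 v z - affF 1 1 u z) := by
  have key := congrArg (fun q => affF 1 1 q z) hA
  simp only [affF_sub'', affF_smul'] at key
  exact key

/-- Rows of the flat chart pull back to rows of the flat piece. -/
theorem rows_blowL (ε : ℚ) (Mc : Fin m' → (Fin (1 + 1) → ℚ) × ℚ)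
    (hMc : ∀ j, (Mc j).1 1 ≠ 0 → (Mc j).2 = 0) (w : Fin (1 + 1 + 1) → ℝ)
    (hw : ∀ j, 0 < affF 1 1 (Fin.append (fun j => chartRowL (Mc j)) (outRowsL ε) j) w) :
    (∀ j, 0 < affF 1 1 (Fin.append Mc (boxRowsL ε) j) (blowL w)) ∧ 0 < w 0 := by
  rw [Fin.forall_fin_add] at hw
  simp only [Fin.append_left, Fin.append_right] at hw
  obtain ⟨hrow, hbox⟩ := hw
  have hρ := (outRowsL_bounds ε w hbox).1
  refine ⟨?_, hρ⟩
  rw [Fin.forall_fin_add]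
  simp only [Fin.append_left, Fin.append_right]
  exact ⟨fun j => (affF_blowL_pos_iff (Mc j) (hMc j) w hρ).2 (hrow j), (boxRowsL_iff ε w).2 hbox⟩

/-- Rows of the steep chart pull back to rows of the steep piece. -/
theorem rows_blowU (ε : ℚ) (Mc : Fin m' → (Fin (1 + 1) → ℚ) × ℚ)
    (hMc : ∀ j, (Mc j).1 1 ≠ 0 → (Mc j).2 = 0) (w : Fin (1 + 1 + 1) → ℝ)
    (hw : ∀ j, 0 < affF 1 1 (Fin.append (fun j => chartRowU (Mc j)) (outRowsU ε) j) w) :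
    (∀ j, 0 < affF 1 1 (Fin.append Mc (boxRowsU ε) j) (blowU w)) ∧ 0 < w 0 ∧ 0 < w 1 := by
  rw [Fin.forall_fin_add] at hw
  simp only [Fin.append_left, Fin.append_right] at hw
  obtain ⟨hrow, hbox⟩ := hw
  obtain ⟨hρ, hξ, -, -⟩ := outRowsU_bounds ε w hbox
  refine ⟨?_, hρ, hξ⟩
  rw [Fin.forall_fin_add]
  simp only [Fin.append_left, Fin.append_right]
  exact ⟨fun j => (affF_blowU_pos_iff (Mc j) (hMc j) w hρ hξ).2 (hrow j), (boxRowsU_iff ε w).2 hbox⟩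

variable (L : Fin m → (Fin 1 → ℚ) × ℚ) (e : Fin m → ℕ) (ℓ₁ : (Fin 1 → ℚ) × ℚ)

/-- **The flat sector piece of a normalised double-corner band is good.** See the module
docstring: blow up (`cornerBlowUp`); the new apex level is the non-zero constant `k`. -/
theorem good_flatPiece (far : Bool) (ε : ℚ) (s : KZ.IntegralRep (1 + 1 + 1))
    (Mc : Fin m' → (Fin (1 + 1) → ℚ) × ℚ) (p : MvPolynomial (Fin 1) ℚ) (u v κ : (Fin (1 + 1) → ℚ) × ℚ)
    (A : ℚ) (hdom : s.domain = gDom 1 1 (m' + 4) (Fin.append Mc (boxRowsL ε)) (fun _ => Sum.inr u)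
      (fun _ => Sum.inr v))
    (hint : EqOn s.integrand (glit 1 1 p L e ℓ₁ 0 0 1 (fun _ => some 0)) s.domain)
    (hMc : ∀ j, (Mc j).1 1 ≠ 0 → (Mc j).2 = 0) (hu0 : u.2 = 0) (hv0 : v.2 = 0) (hκ0 : κ.2 = 0)
    (hκy : κ.1 1 = 0) (hA : u - κ = A • (v - u)) (hA0 : 0 < A)
    (hcell : ∀ z : Fin (1 + 1 + 1) → ℝ, (∀ j, 0 < affF 1 1 (Fin.append Mc (boxRowsL ε) j) z) →
      bif far then (0 < affF 1 1 κ z ∧ affF 1 1 u z < affF 1 1 v z ∧ 2 * affF 1 1 κ z ≤ affF 1 1 v z)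
      else (affF 1 1 κ z < 0 ∧ 0 < affF 1 1 u z ∧ affF 1 1 u z < affF 1 1 v z)) :
    ∃ c ∈ AddSubgroup.closure (GGset 1 2 1), KZ.of s - c ∈ KZ.relations := by
  obtain ⟨s', hbd', hdom', hint', -, hrel⟩ := cornerBlowUp ε s Mc L e p ℓ₁ u v hdom hint hMc hu0 hv0
  suffices hs' : ∃ c ∈ AddSubgroup.closure (GGset 1 2 1), KZ.of s' - c ∈ KZ.relations by
    obtain ⟨c₀, hc₀, hc₀'⟩ := hs'
    exact ⟨c₀, hc₀, by have := add_mem hrel hc₀'; rwa [sub_add_sub_cancel] at this⟩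
  have hκc : ∀ z : Fin (1 + 1 + 1) → ℝ, affF 1 1 (chartFL κ) z = (κ.1 0 : ℝ) := fun z => by
    rw [affF_two, chartFL]
    simp [hκy]
  have hcell' : ∀ w : Fin (1 + 1 + 1) → ℝ,
      (∀ j, 0 < affF 1 1 (Fin.append (fun j => chartRowL (Mc j)) (outRowsL ε) j) w) →
      bif far then (0 < affF 1 1 (chartFL κ) w ∧ affF 1 1 (chartFL u) w < affF 1 1 (chartFL v) w ∧
        2 * affF 1 1 (chartFL κ) w ≤ affF 1 1 (chartFL v) w)
      else (affF 1 1 (chartFL κ) w < 0 ∧ 0 < affF 1 1 (chartFL u) w ∧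
        affF 1 1 (chartFL u) w < affF 1 1 (chartFL v) w) := by
    intro w hw
    obtain ⟨hz, hρ⟩ := rows_blowL ε Mc hMc w hw
    have h := hcell (blowL w) hz
    rw [affF_blowL_eq κ hκ0, affF_blowL_eq u hu0, affF_blowL_eq v hv0, reg_mul far hρ] at h
    exact h
  refine good_noCorner_reg L e ℓ₁ 0 0 1 far s' _ p (chartFL u) (chartFL v) (chartFL κ) A (Or.inl rfl)
    hbd' hdom' (by rw [hint']; exact fun _ _ => rfl) (apex_map chartFL_sub chartFL_smul hA) hA0 hcell'
    fun z hz hκz _ _ => ?_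
  obtain ⟨z₀, hz₀⟩ := closure_nonempty_iff.1 ⟨z, hz⟩
  have h := reg_ne far (hcell' z₀ hz₀)
  rw [hκc] at h hκz
  exact h hκz

/-- **The steep sector piece of a normalised double-corner band is good.** See the module
docstring: blow up (`cornerBlowUpSteep`); the new bounds depend on `ξ` only. -/
theorem good_steepPiece (far : Bool) (ε : ℚ) (s : KZ.IntegralRep (1 + 1 + 1))
    (Mc : Fin m' → (Fin (1 + 1) → ℚ) × ℚ) (p : MvPolynomial (Fin 1) ℚ) (u v κ : (Fin (1 + 1) → ℚ) × ℚ)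
    (A : ℚ) (hdom : s.domain = gDom 1 1 (m' + 4) (Fin.append Mc (boxRowsU ε)) (fun _ => Sum.inr u)
      (fun _ => Sum.inr v))
    (hint : EqOn s.integrand (glit 1 1 p L e ℓ₁ 0 0 1 (fun _ => some 0)) s.domain)
    (hMc : ∀ j, (Mc j).1 1 ≠ 0 → (Mc j).2 = 0) (hu0 : u.2 = 0) (hv0 : v.2 = 0)
    (hA : u - κ = A • (v - u)) (hA0 : 0 < A)
    (hcell : ∀ z : Fin (1 + 1 + 1) → ℝ, (∀ j, 0 < affF 1 1 (Fin.append Mc (boxRowsU ε) j) z) →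
      bif far then (0 < affF 1 1 κ z ∧ affF 1 1 u z < affF 1 1 v z ∧ 2 * affF 1 1 κ z ≤ affF 1 1 v z)
      else (affF 1 1 κ z < 0 ∧ 0 < affF 1 1 u z ∧ affF 1 1 u z < affF 1 1 v z)) :
    ∃ c ∈ AddSubgroup.closure (GGset 1 2 1), KZ.of s - c ∈ KZ.relations := by
  obtain ⟨s', hbd', hdom', hint', -, hrel⟩ := cornerBlowUpSteep ε s Mc L e p ℓ₁ u v hdom hint hMc hu0 hv0
  suffices hs' : ∃ c ∈ AddSubgroup.closure (GGset 1 2 1), KZ.of s' - c ∈ KZ.relations by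
    obtain ⟨c₀, hc₀, hc₀'⟩ := hs'
    exact ⟨c₀, hc₀, by have := add_mem hrel hc₀'; rwa [sub_add_sub_cancel] at this⟩
  have hA0' : (0 : ℝ) < A := by exact_mod_cast hA0
  refine good_xfree_band L e ℓ₁ 0 0 1 s' _ p (chartFU u) (chartFU v) (Or.inl rfl) hbd' hdom'
    (by rw [hint']; exact fun _ _ => rfl) (fun i => by fin_cases i; simp [chartFU])
    (fun i => by fin_cases i; simp [chartFU]) fun w hw => ?_
  obtain ⟨hz, hρ, hξ⟩ := rows_blowU ε Mc hMc w hw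
  have hq : 0 < w 0 / w 1 := div_pos hρ hξ
  obtain ⟨h1, h2⟩ := reg_pos far (hcell (blowU w) hz) (apex_eval hA (blowU w)) hA0'
  rw [affF_blowU_eq u hu0 w hξ.ne'] at h1 h2
  rw [affF_blowU_eq v hv0 w hξ.ne'] at h2
  exact ⟨pos_of_mul_pos_right h1 hq.le, lt_of_mul_lt_mul_left h2 hq.le⟩

end Pieces

end RebasePos

/-- **Registered part of `stub_rebaseSimplePosOneZero` (line `janus-bands`): the steep sector
piece of a normalised double-corner band is good** (`RebasePos.good_steepPiece`): the literal
one-fibre datum over the steep piece `{rows, 0 < x < y < ε, u < t < v}` at a corner at the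
origin (base pole `y = 0`, letter `0`, rows and bounds through the origin, apex level `κ` with
`u − κ = A (v − u)`, `A > 0`, in the thick or the far regime) is congruent modulo
`KZ.relations` to the subgroup generated by `GG 1 2 1`: blow up by `RebasePos.cornerBlowUpSteep`
(rule 2), then `RebasePos.good_xfree_band`. -/
theorem rebaseSimplePos_steepPiece (m m' : ℕ) (L : Fin m → (Fin 1 → ℚ) × ℚ) (e : Fin m → ℕ) (ℓ₁ : (Fin 1 → ℚ) × ℚ) (far : Bool) (ε : ℚ) (s : KZ.IntegralRep (1 + 1 + 1)) (Mc : Fin m' → (Fin (1 + 1) → ℚ) × ℚ) (p : MvPolynomial (Fin 1) ℚ) (u v κ : (Fin (1 + 1) → ℚ) × ℚ) (A : ℚ) (hdom : s.domain = SeparatePos.gDom 1 1 (m' + 4) (Fin.append Mc (RebasePos.boxRowsU ε)) (fun _ => Sum.inr u) (fun _ => Sum.inr v)) (hint : EqOn s.integrand (RebasePos.glit 1 1 p L e ℓ₁ 0 0 1 (fun _ => some 0)) s.domain) (hMc : ∀ j, (Mc j).1 1 ≠ 0 → (Mc j).2 = 0) (hu0 : u.2 = 0) (hv0 : v.2 =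 0) (hA : u - κ = A • (v - u)) (hA0 : 0 < A) (hcell : ∀ z : Fin (1 + 1 + 1) → ℝ, (∀ j, 0 < SeparatePos.affF 1 1 (Fin.append Mc (RebasePos.boxRowsU ε) j) z) → bif far then (0 < SeparatePos.affF 1 1 κ z ∧ SeparatePos.affF 1 1 u z < SeparatePos.affF 1 1 v z ∧ 2 * SeparatePos.affF 1 1 κ z ≤ SeparatePos.affF 1 1 v z) else (SeparatePos.affF 1 1 κ z < 0 ∧ 0 < SeparatePos.affF 1 1 u z ∧ SeparatePos.affF 1 1 u z < SeparatePos.affF 1 1 v z)) : ∃ c ∈ AddSubgroup.closure (SeparatePos.GGset 1 2 1), KZ.of s - c ∈ KZ.relations :=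
  RebasePos.good_steepPiece L e ℓ₁ far ε s Mc p u v κ A hdom hint hMc hu0 hv0 hA hA0 hcell

end Summit.KontsevichZagierPeriods.ArrangementNormalForm.JanusBands
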